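import Literature.Geometry.Symplectic.PencilEndGluing
import Literature.Geometry.Symplectic.JPlanePencilCorePositivity
import Literature.Geometry.Symplectic.JPlanePencilFamilyOrientation
import Literature.Topology.FourManifolds.GluedDesc
import HarnessLib

/-!
# The almost complex structure of the blown-up partial end-compactification

Topic `Literature/Geometry/Symplectic` (infrastructure for
`Literature.Geometry.Symplectic.jPlanePencil_localFamily_homotopySphere`, Wendl LNM 2216, proof of
Prop. 2.53, p. 65). On the glued manifold `Y = (M ∖ p) ∪_ψ Ω` of `PencilEndGluing.lean` we define
the almost complex structure `JY` which is the given `J` on `M ∖ p` and the standard structure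
`i` in the blown-up coordinates `(x', w)` of the box `Ω`; the two agree on the overlap because
`J` is standard in the flat coordinates `(z, w)` (`⟪Dψ(Jv), c⟫ = ω₀(Dψ v, c)`, i.e. `J = ψ^* i`)
and `(z, w) ↦ (1/z, w)` is holomorphic.

## Main results

* chart bookkeeping of `Y`: `chartAt_inP`, `extChartAt_inP_symm_apply`, `tangentCoordChange_inP`
  (changes of tangent coordinates between points of `M ∖ p` are those of `M ∖ p`),
  `chartAt_inB` (at points of the exceptional disc the chart is the box chart);
* `PencilEnd.JY`: the structure; `JY_inP`, `JY_inB`; `JY_JY`;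
* `contMDiffAt_inTangentCoordinates_JY_inP`: smoothness at points of `M ∖ p`;
* (sequel) smoothness at the exceptional disc and the packaged `AlmostComplexStructure`.

## References

* C. Wendl, *Holomorphic Curves in Low Dimensions*, LNM 2216 (2018), proof of Prop. 2.53, p. 65.
  [Wendl2018]
* A. Kosinski, *Differential Manifolds* (1993), VI.1. [Kosinski1993]
-/

noncomputable section

open scoped Manifold ContDiff Topology
open Set Function Metric Filter Literature.Topology.FourManifolds

namespace Literature.Geometry.Symplectic

/-! ### The derivative of the flat coordinates and its complex linearity -/

section Flat

variable {M : Type*} [TopologicalSpace M] [T2Space M] [ChartedSpace (EuclideanSpace ℝ (Fin 4)) M]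
  [IsManifold (𝓡 4) ∞ M] {p : M}
  (J : punctured p → (EuclideanSpace ℝ (Fin 4) →L[ℝ] EuclideanSpace ℝ (Fin 4)))

/-- The derivative of the flat coordinates at `c`, as a map of the model spaces
(`mfderiv (𝓡 4) 𝓘(ℝ, ℂ × ℂ) (pencilCoord p) c`, with `TangentSpace (𝓡 4) c = ℝ⁴` unfolded).
[folklore] -/
def pencilCoordDeriv (c : punctured p) : EuclideanSpace ℝ (Fin 4) →L[ℝ] ℂ × ℂ :=
  mfderiv (𝓡 4) 𝓘(ℝ, ℂ × ℂ) (pencilCoord p) c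

omit [T2Space M] [IsManifold (𝓡 4) ∞ M] in
/-- Unfolding of `pencilCoordDeriv`. [folklore] -/
theorem pencilCoordDeriv_def [T2Space M] (c : punctured p) :
    pencilCoordDeriv c = mfderiv (𝓡 4) 𝓘(ℝ, ℂ × ℂ) (pencilCoord p) c := rfl

/-- **The flat coordinates have derivative `flatCx ∘ Dι ∘ D(e ∘ val)`** on the punctured chart
ball. [folklore] -/
theorem hasMFDerivAt_pencilCoord {c : punctured p} {ε : ℝ} (hc : InPuncturedChartBall p ε c) :
    HasMFDerivAt (𝓡 4) 𝓘(ℝ, ℂ × ℂ) (pencilCoord p) c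
      ((flatCx : EuclideanSpace ℝ (Fin 4) →L[ℝ] ℂ × ℂ).comp
        ((fderiv ℝ inversion (extChartAt (𝓡 4) p c.1 - extChartAt (𝓡 4) p p)).comp
          (mfderiv (𝓡 4) 𝓘(ℝ, EuclideanSpace ℝ (Fin 4))
            (fun z : punctured p => extChartAt (𝓡 4) p z.1) c))) := by
  have hψ := hasMFDerivAt_flatCoord p hc
  have hfl : HasMFDerivAt 𝓘(ℝ, EuclideanSpace ℝ (Fin 4)) 𝓘(ℝ, ℂ × ℂ)
      (flatCx : EuclideanSpace ℝ (Fin 4) → ℂ × ℂ)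
      (inversion (extChartAt (𝓡 4) p c.1 - extChartAt (𝓡 4) p p))
      (flatCx : EuclideanSpace ℝ (Fin 4) →L[ℝ] ℂ × ℂ) :=
    hasMFDerivAt_iff_hasFDerivAt.2 flatCx.hasFDerivAt
  have heq : (pencilCoord p : punctured p → ℂ × ℂ) =
      (flatCx : EuclideanSpace ℝ (Fin 4) → ℂ × ℂ) ∘
        fun z : punctured p => inversion (extChartAt (𝓡 4) p z.1 - extChartAt (𝓡 4) p p) :=
    funext fun z => pencilCoord_eq_flatCx p z
  rw [heq]
  exact hfl.comp c hψ

/-- **In the flat coordinates `J` is multiplication by `i`**: for `J` standard on the punctured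
`ε`-chart-ball, `D(pencilCoord)(J v) = i • D(pencilCoord) v` there. [cite: Gromov1985, 2.4.A'] -/
theorem pencilCoordDeriv_J {ε : ℝ}
    (hJstd : ∀ x : punctured p, InPuncturedChartBall p ε x →
      ∀ (v : TangentSpace (𝓡 4) x) (c : EuclideanSpace ℝ (Fin 4)),
        inner ℝ (fderiv ℝ inversion (extChartAt (𝓡 4) p x.1 - extChartAt (𝓡 4) p p)
          (mfderiv (𝓡 4) 𝓘(ℝ, EuclideanSpace ℝ (Fin 4))
            (fun z : punctured p => extChartAt (𝓡 4) p z.1) x (J x v))) c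
        = stdSymplecticForm (fderiv ℝ inversion (extChartAt (𝓡 4) p x.1 - extChartAt (𝓡 4) p p)
          (mfderiv (𝓡 4) 𝓘(ℝ, EuclideanSpace ℝ (Fin 4))
            (fun z : punctured p => extChartAt (𝓡 4) p z.1) x v)) c)
    {c : punctured p} (hc : InPuncturedChartBall p ε c) (v : EuclideanSpace ℝ (Fin 4)) :
    pencilCoordDeriv c (J c v) = Complex.I • pencilCoordDeriv c v := by
  rw [pencilCoordDeriv, (hasMFDerivAt_pencilCoord hc).mfderiv]
  exact flatCx_dpsi_J hJstd hc v

/-- The flat coordinates written in the extended chart at `c` have Fréchet derivative the manifold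
derivative. [folklore] -/
theorem hasFDerivAt_pencilCoord_comp_extChartAt_symm {c : punctured p} {ε : ℝ}
    (hc : InPuncturedChartBall p ε c) :
    HasFDerivAt ((pencilCoord p : punctured p → ℂ × ℂ) ∘ (extChartAt (𝓡 4) c).symm)
      (pencilCoordDeriv c) (extChartAt (𝓡 4) c c) := by
  have h := hasMFDerivAt_pencilCoord hc
  have h2 := h.2
  rw [← h.mfderiv] at h2
  simp only [writtenInExtChartAt, extChartAt_model_space_eq_id, PartialEquiv.refl_coe,
    Function.id_comp, ModelWithCorners.Boundaryless.range_eq_univ] at h2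
  exact h2.hasFDerivAt_of_univ

/-- `flatI ∘ flatCx⁻¹ = flatCx⁻¹ ∘ (i • ·)`. [folklore] -/
theorem flatI_flatCx_symm (z : ℂ × ℂ) : flatI (flatCx.symm z) = flatCx.symm (Complex.I • z) := by
  apply flatCx.injective
  rw [flatCx_flatI, ContinuousLinearEquiv.apply_symm_apply, ContinuousLinearEquiv.apply_symm_apply]

end Flat

namespace PencilEnd

variable {M : Type*} [TopologicalSpace M] [T2Space M] [ChartedSpace (EuclideanSpace ℝ (Fin 4)) M]
  [IsManifold (𝓡 4) ∞ M] {p : M} (G : PencilEnd p)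

/-! ### Charts of `Y` at points of `M ∖ p` -/

/-- The preferred chart of `Y` at `inP a` is the lift of the preferred chart of `M ∖ p` at `a`.
[folklore] -/
theorem chartAt_inP (a : punctured p) :
    chartAt (EuclideanSpace ℝ (Fin 4)) (G.inP a) =
      G.glueData.chartA (chartAt (EuclideanSpace ℝ (Fin 4)) a) := by
  classical
  have h : ∃ a', G.glueData.inl a' = G.inP a := ⟨a, rfl⟩
  change (if h : ∃ a', G.glueData.inl a' = G.inP a then
      G.glueData.chartA (chartAt (EuclideanSpace ℝ (Fin 4)) (Classical.choose h))
    else G.glueData.chartB (chartAt (ℂ × ℂ)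
      (Classical.choose ((G.glueData.exists_inl_or_inr (G.inP a)).resolve_left h)))) = _
  rw [dif_pos h, G.glueData.inl_injective (Classical.choose_spec h)]

/-- The lifted chart applied to a point of `M ∖ p`. [folklore] -/
theorem chartA_apply_inP (e : OpenPartialHomeomorph (punctured p) (EuclideanSpace ℝ (Fin 4)))
    (a : punctured p) : G.glueData.chartA e (G.inP a) = e a := by
  rw [SmoothGlueData.chartA_apply_inl, glueData_linA, ContinuousLinearEquiv.refl_apply,
    modelWithCornersSelf_coe, id]

/-- The inverse of the lifted chart. [folklore] -/
theorem chartA_symm_apply (e : OpenPartialHomeomorph (punctured p) (EuclideanSpace ℝ (Fin 4)))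
    (u : EuclideanSpace ℝ (Fin 4)) : (G.glueData.chartA e).symm u = G.inP (e.symm u) := by
  simp only [SmoothGlueData.chartA, OpenPartialHomeomorph.lift_openEmbedding_symm, comp_apply,
    OpenPartialHomeomorph.transHomeomorph_symm_apply, SmoothGlueData.modelHomeoA_symm_apply,
    glueData_linA, ContinuousLinearEquiv.refl_symm, ContinuousLinearEquiv.refl_apply,
    modelWithCornersSelf_coe_symm, id]

/-- The extended chart of `Y` at `inP a`, applied to `inP c`. [folklore] -/
theorem extChartAt_inP_apply (a c : punctured p) :
    extChartAt (𝓡 4) (G.inP a) (G.inP c) = extChartAt (𝓡 4) a c := by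
  simp only [extChartAt, OpenPartialHomeomorph.extend_coe, comp_apply, chartAt_inP,
    chartA_apply_inP]

/-- The inverse extended chart of `Y` at `inP a`. [folklore] -/
theorem extChartAt_inP_symm_apply (a : punctured p) (u : EuclideanSpace ℝ (Fin 4)) :
    (extChartAt (𝓡 4) (G.inP a)).symm u = G.inP ((extChartAt (𝓡 4) a).symm u) := by
  simp only [extChartAt, OpenPartialHomeomorph.extend_coe_symm, comp_apply, chartAt_inP,
    chartA_symm_apply, modelWithCornersSelf_coe_symm, id]

/-- The source of the extended chart of `Y` at `inP a`. [folklore] -/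
theorem extChartAt_inP_source (a : punctured p) :
    (extChartAt (𝓡 4) (G.inP a)).source = G.inP '' (extChartAt (𝓡 4) a).source := by
  rw [extChartAt_source, extChartAt_source, chartAt_inP, SmoothGlueData.chartA_source]

/-- The transition maps of `Y` between charts at points of `M ∖ p` are those of `M ∖ p`.
[folklore] -/
theorem extChartAt_inP_comp_symm (a a' : punctured p) :
    (extChartAt (𝓡 4) (G.inP a') : G.Y → EuclideanSpace ℝ (Fin 4)) ∘ (extChartAt (𝓡 4) (G.inP a)).symm =
      (extChartAt (𝓡 4) a' : punctured p → EuclideanSpace ℝ (Fin 4)) ∘ (extChartAt (𝓡 4) a).symm := by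
  funext u
  rw [comp_apply, comp_apply, extChartAt_inP_symm_apply, extChartAt_inP_apply]

/-- **Changes of tangent coordinates of `Y` between points of `M ∖ p` are those of `M ∖ p`.**
[cite: Kosinski1993, VI.1] -/
theorem tangentCoordChange_inP (a a' c : punctured p) :
    tangentCoordChange (𝓡 4) (G.inP a) (G.inP a') (G.inP c) = tangentCoordChange (𝓡 4) a a' c := by
  rw [tangentCoordChange_def, tangentCoordChange_def, extChartAt_inP_comp_symm,
    extChartAt_inP_apply]

/-- `tangentCoordChange_inP` in terms of the tangent bundle cores. [folklore] -/
theorem coordChange_inP (a a' c : punctured p) :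
    (tangentBundleCore (𝓡 4) G.Y).coordChange (achart (EuclideanSpace ℝ (Fin 4)) (G.inP a))
        (achart (EuclideanSpace ℝ (Fin 4)) (G.inP a')) (G.inP c) =
      (tangentBundleCore (𝓡 4) (punctured p)).coordChange (achart (EuclideanSpace ℝ (Fin 4)) a)
        (achart (EuclideanSpace ℝ (Fin 4)) a') c :=
  G.tangentCoordChange_inP a a' c

/-! ### Charts of `Y` at points of the exceptional disc -/

/-- The preferred chart of `Y` at a point `inB q` of the exceptional disc (`x' = 0`) is the lift of
the box chart. [folklore] -/
theorem chartAt_inB {q : G.box} (hq : (q : ℂ × ℂ).1 = 0) :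
    chartAt (EuclideanSpace ℝ (Fin 4)) (G.inB q) = G.glueData.chartB (chartAt (ℂ × ℂ) q) := by
  classical
  have h : ¬ ∃ a, G.glueData.inl a = G.inB q := fun ⟨a, ha⟩ => G.inB_notMem_range_inP hq ⟨a, ha⟩
  change (if h : ∃ a', G.glueData.inl a' = G.inB q then
      G.glueData.chartA (chartAt (EuclideanSpace ℝ (Fin 4)) (Classical.choose h))
    else G.glueData.chartB (chartAt (ℂ × ℂ)
      (Classical.choose ((G.glueData.exists_inl_or_inr (G.inB q)).resolve_left h)))) = _
  rw [dif_neg h, G.glueData.inr_injective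
    (Classical.choose_spec ((G.glueData.exists_inl_or_inr (G.inB q)).resolve_left h))]

omit [T2Space M] [IsManifold (𝓡 4) ∞ M] in
/-- The box chart at any point is the restriction of the identity chart of `ℂ²` (so it does not
depend on the point). [folklore] -/
theorem chartAt_box (q q' : G.box) : chartAt (ℂ × ℂ) q = chartAt (ℂ × ℂ) q' := rfl

omit [T2Space M] [IsManifold (𝓡 4) ∞ M] in
/-- The box chart is the inclusion. [folklore] -/
theorem chartAt_box_apply (q b : G.box) : chartAt (ℂ × ℂ) q b = (b : ℂ × ℂ) := rfl

/-- The lifted box chart applied to a box point: `flatCx⁻¹` of its coordinates. [folklore] -/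
theorem chartB_apply_inB (q b : G.box) :
    G.glueData.chartB (chartAt (ℂ × ℂ) q) (G.inB b) = flatCx.symm (b : ℂ × ℂ) := by
  rw [SmoothGlueData.chartB_apply_inr]
  rfl

/-- At two points of the exceptional disc the preferred charts of `Y` coincide. [folklore] -/
theorem chartAt_inB_eq {q q' : G.box} (hq : (q : ℂ × ℂ).1 = 0) (hq' : (q' : ℂ × ℂ).1 = 0) :
    chartAt (EuclideanSpace ℝ (Fin 4)) (G.inB q) = chartAt (EuclideanSpace ℝ (Fin 4)) (G.inB q') := by
  rw [chartAt_inB G hq, chartAt_inB G hq']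
  rfl

/-- **Between two points of the exceptional disc the change of tangent coordinates is the
identity** (same chart). [folklore] -/
theorem tangentCoordChange_inB_inB {q q' : G.box} (hq : (q : ℂ × ℂ).1 = 0)
    (hq' : (q' : ℂ × ℂ).1 = 0) {y : G.Y}
    (hy : y ∈ (extChartAt (𝓡 4) (G.inB q)).source) (v : EuclideanSpace ℝ (Fin 4)) :
    tangentCoordChange (𝓡 4) (G.inB q) (G.inB q') y v = v := by
  have h : extChartAt (𝓡 4) (G.inB q') = extChartAt (𝓡 4) (G.inB q) := by
    simp only [extChartAt, chartAt_inB_eq G hq' hq]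
  have key : tangentCoordChange (𝓡 4) (G.inB q) (G.inB q') y =
      tangentCoordChange (𝓡 4) (G.inB q) (G.inB q) y := by
    rw [tangentCoordChange_def, tangentCoordChange_def, h]
  rw [key]
  exact tangentCoordChange_self hy

/-! ### The structure `JY` -/

/- We read `J` as a field of endomorphisms of the model `ℝ⁴` (`TangentSpace (𝓡 4) x = ℝ⁴`
definitionally; the fact's `J : ∀ x, TangentSpace (𝓡 4) x →L[ℝ] TangentSpace (𝓡 4) x` is such a
field). -/
variable (J : punctured p → (EuclideanSpace ℝ (Fin 4) →L[ℝ] EuclideanSpace ℝ (Fin 4)))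

open Classical in
/-- **The almost complex structure of the blown-up end-compactification** (as a pointwise field
of endomorphisms of the model `ℝ⁴`, read in the preferred charts of `Y`): `J a` at `inP a`, the
standard structure `flatI = flatCx⁻¹ ∘ i ∘ flatCx` at the points of the exceptional disc.
[cite: Wendl2018, proof of Prop. 2.53 (p. 65)] -/
def JY (y : G.Y) : EuclideanSpace ℝ (Fin 4) →L[ℝ] EuclideanSpace ℝ (Fin 4) :=
  if h : ∃ a, G.inP a = y then J (Classical.choose h) else flatI

/-- On `M ∖ p` the structure is `J`. [folklore] -/
theorem JY_inP (a : punctured p) : G.JY J (G.inP a) = J a := by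
  have h : ∃ a', G.inP a' = G.inP a := ⟨a, rfl⟩
  rw [JY, dif_pos h, G.glueData.inl_injective (Classical.choose_spec h)]

/-- On the exceptional disc the structure is `flatI`. [folklore] -/
theorem JY_inB {q : G.box} (hq : (q : ℂ × ℂ).1 = 0) : G.JY J (G.inB q) = flatI := by
  have h : ¬ ∃ a, G.inP a = G.inB q := fun ⟨a, ha⟩ => G.inB_notMem_range_inP hq ⟨a, ha⟩
  rw [JY, dif_neg h]

/-- `flatI² = -1`. [folklore] -/
theorem flatI_flatI (v : EuclideanSpace ℝ (Fin 4)) : flatI (flatI v) = -v := by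
  apply flatCx.injective
  rw [flatCx_flatI, flatCx_flatI, smul_smul, Complex.I_mul_I, neg_one_smul, map_neg]

/-- **`JY² = -1`.** [folklore] -/
theorem JY_JY (hJ2 : ∀ (x : punctured p) (v : EuclideanSpace ℝ (Fin 4)), J x (J x v) = -v) (y : G.Y)
    (v : EuclideanSpace ℝ (Fin 4)) : G.JY J y (G.JY J y v) = -v := by
  by_cases h : ∃ a, G.inP a = y
  · obtain ⟨a, rfl⟩ := h
    rw [JY_inP]
    exact hJ2 a v
  · rw [JY, dif_neg h]
    exact flatI_flatI v

/-! ### Smoothness at points of `M ∖ p` -/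

/-- In tangent coordinates of `Y` centred at `inP a₀`, the structure composed with `inP` is, near
`a₀`, the structure `J` in tangent coordinates of `M ∖ p` centred at `a₀`. [folklore] -/
theorem inTangentCoordinates_JY_inP {a₀ a : punctured p}
    (ha : a ∈ (chartAt (EuclideanSpace ℝ (Fin 4)) a₀).source) :
    inTangentCoordinates (𝓡 4) (𝓡 4) (id : G.Y → G.Y) id (fun y => G.JY J y) (G.inP a₀) (G.inP a) =
      inTangentCoordinates (𝓡 4) (𝓡 4) (id : punctured p → punctured p) id (fun x => J x) a₀ a := by
  have haY : G.inP a ∈ (chartAt (EuclideanSpace ℝ (Fin 4)) (G.inP a₀)).source := by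
    rw [chartAt_inP, SmoothGlueData.chartA_source]
    exact ⟨a, ha, rfl⟩
  rw [inTangentCoordinates_eq (id : G.Y → G.Y) id (fun y => G.JY J y) (x₀ := G.inP a₀)
      (x := G.inP a) haY haY,
    inTangentCoordinates_eq (id : punctured p → punctured p) id (fun x => J x) (x₀ := a₀)
      (x := a) ha ha]
  dsimp only [id]
  rw [coordChange_inP, coordChange_inP, JY_inP]

/-- **Smoothness of `JY` at points of `M ∖ p`** (in tangent coordinates), from that of `J`.
[cite: Wendl2018, proof of Prop. 2.53 (p. 65)] -/
theorem contMDiffAt_inTangentCoordinates_JY_inP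
    (hJs : ∀ x₀ : punctured p, ContMDiffAt (𝓡 4) 𝓘(ℝ, EuclideanSpace ℝ (Fin 4) →L[ℝ]
      EuclideanSpace ℝ (Fin 4)) ∞
      (inTangentCoordinates (𝓡 4) (𝓡 4) (id : punctured p → punctured p) id (fun x => J x) x₀) x₀)
    (a₀ : punctured p) :
    ContMDiffAt (𝓡 4) 𝓘(ℝ, EuclideanSpace ℝ (Fin 4) →L[ℝ] EuclideanSpace ℝ (Fin 4)) ∞
      (inTangentCoordinates (𝓡 4) (𝓡 4) (id : G.Y → G.Y) id (fun y => G.JY J y) (G.inP a₀))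
      (G.inP a₀) := by
  refine contMDiffAt_of_comp_isImmersionAt
    (G.glueData.isSmoothEmbedding_inl.isImmersion.isImmersionAt a₀) G.glueData.isOpenMap_inl
    (g := fun a => inTangentCoordinates (𝓡 4) (𝓡 4) (id : G.Y → G.Y) id (fun y => G.JY J y)
      (G.inP a₀) (G.inP a)) ?_ (fun _ => rfl)
  refine (hJs a₀).congr_of_eventuallyEq ?_
  filter_upwards [(chartAt (EuclideanSpace ℝ (Fin 4)) a₀).open_source.mem_nhds
    (mem_chart_source _ a₀)] with a ha
  exact G.inTangentCoordinates_JY_inP J ha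

/-! ### The extended chart at a point of the exceptional disc -/

omit [T2Space M] [IsManifold (𝓡 4) ∞ M] in
/-- The source of the box chart is everything. [folklore] -/
theorem chartAt_box_source (q : G.box) : (chartAt (ℂ × ℂ) q).source = univ := by
  rw [TopologicalSpace.Opens.chartAt_eq, OpenPartialHomeomorph.subtypeRestr_source, chartAt_self_eq,
    OpenPartialHomeomorph.refl_source, preimage_univ]

/-- The source of the extended chart of `Y` at a point of the exceptional disc is the image of the
box. [folklore] -/
theorem extChartAt_inB_source {q : G.box} (hq : (q : ℂ × ℂ).1 = 0) :
    (extChartAt (𝓡 4) (G.inB q)).source = range G.inB := by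
  rw [extChartAt_source, chartAt_inB G hq, SmoothGlueData.chartB_source, chartAt_box_source,
    image_univ]

/-- The extended chart at a point of the exceptional disc, on box points. [folklore] -/
theorem extChartAt_inB_apply_inB {q : G.box} (hq : (q : ℂ × ℂ).1 = 0) (b : G.box) :
    extChartAt (𝓡 4) (G.inB q) (G.inB b) = flatCx.symm (b : ℂ × ℂ) := by
  simp only [extChartAt, OpenPartialHomeomorph.extend_coe, comp_apply, chartAt_inB G hq,
    chartB_apply_inB, modelWithCornersSelf_coe, id]

/-- A point of the gluing region, seen in the box. [folklore] -/
theorem inP_eq_inB_glueFun {c : punctured p} (hc : c ∈ G.src) : G.inP c = G.inB (G.glueFun c) :=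
  G.inP_eq_inB_iff.2 ⟨hc, rfl⟩

/-- The extended chart at a point of the exceptional disc, on points of the gluing region:
`flatCx⁻¹ (1/z, w)`. [folklore] -/
theorem extChartAt_inB_apply_inP {q : G.box} (hq : (q : ℂ × ℂ).1 = 0) {c : punctured p}
    (hc : c ∈ G.src) :
    extChartAt (𝓡 4) (G.inB q) (G.inP c) = flatCx.symm (blowDown (pencilCoord p c)) := by
  rw [G.inP_eq_inB_glueFun hc, extChartAt_inB_apply_inB G hq, G.glueFun_of_mem hc]
  rfl

/-- A point of the gluing region lies in the source of the chart at a point of the exceptional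
disc. [folklore] -/
theorem inP_mem_extChartAt_inB_source {q : G.box} (hq : (q : ℂ × ℂ).1 = 0) {c : punctured p}
    (hc : c ∈ G.src) : G.inP c ∈ (extChartAt (𝓡 4) (G.inB q)).source := by
  rw [extChartAt_inB_source G hq, G.inP_eq_inB_glueFun hc]
  exact ⟨_, rfl⟩


/-! ### The change of tangent coordinates from `M ∖ p` to the exceptional chart -/

/-- **The change of tangent coordinates of `Y` from the chart at a point `inP c` of the gluing
region to the chart at a point of the exceptional disc** is the derivative of
`flatCx⁻¹ ∘ (z, w) ↦ (1/z, w) ∘ pencilCoord`: `flatCx⁻¹ ∘ blowDownDeriv (z c) ∘ D(pencilCoord)(c)`.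
[cite: Kosinski1993, VI.1] -/
theorem tangentCoordChange_inP_inB {q : G.box} (hq : (q : ℂ × ℂ).1 = 0) {c : punctured p}
    (hc : c ∈ G.src) :
    tangentCoordChange (𝓡 4) (G.inP c) (G.inB q) (G.inP c) =
      (flatCx.symm : ℂ × ℂ →L[ℝ] EuclideanSpace ℝ (Fin 4)).comp
        ((blowDownDeriv (pencilCoord p c).1).comp (pencilCoordDeriv c)) := by
  set u₀ := extChartAt (𝓡 4) c c with hu₀
  -- the honest derivative of the change of charts
  have hD := hasFDerivWithinAt_tangentCoordChange (I := 𝓡 4) (x := G.inP c) (y := G.inB q)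
    (z := G.inP c) ⟨mem_extChartAt_source (G.inP c), G.inP_mem_extChartAt_inB_source hq hc⟩
  rw [ModelWithCorners.Boundaryless.range_eq_univ, extChartAt_inP_apply] at hD
  have hD' := hD.hasFDerivAt_of_univ
  -- the same function near `u₀`, as `flatCx⁻¹ ∘ blowDown ∘ pencilCoord ∘ (chart at c)⁻¹`
  have hsymm : ContinuousAt (extChartAt (𝓡 4) c).symm u₀ :=
    (continuousOn_extChartAt_symm c).continuousAt
      ((isOpen_extChartAt_target c).mem_nhds (mem_extChartAt_target c))
  have hc0 : (extChartAt (𝓡 4) c).symm u₀ = c := extChartAt_to_inv c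
  have hev : ((extChartAt (𝓡 4) (G.inB q) : G.Y → EuclideanSpace ℝ (Fin 4)) ∘
      (extChartAt (𝓡 4) (G.inP c)).symm) =ᶠ[𝓝 u₀]
      fun u => flatCx.symm (blowDown (pencilCoord p ((extChartAt (𝓡 4) c).symm u))) := by
    have hmem : ∀ᶠ u in 𝓝 u₀, (extChartAt (𝓡 4) c).symm u ∈ G.src := by
      refine hsymm.preimage_mem_nhds (G.isOpen_src.mem_nhds ?_)
      rw [hc0]; exact hc
    filter_upwards [hmem] with u hu
    rw [comp_apply, extChartAt_inP_symm_apply, G.extChartAt_inB_apply_inP hq hu]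
  have hT : HasFDerivAt (fun u => flatCx.symm (blowDown (pencilCoord p ((extChartAt (𝓡 4) c).symm u))))
      ((flatCx.symm : ℂ × ℂ →L[ℝ] EuclideanSpace ℝ (Fin 4)).comp
        ((blowDownDeriv (pencilCoord p c).1).comp (pencilCoordDeriv c)))
      u₀ := by
    have h1 := hasFDerivAt_pencilCoord_comp_extChartAt_symm hc.1
    have h2 : HasFDerivAt blowDown (blowDownDeriv (pencilCoord p c).1)
        (((pencilCoord p : punctured p → ℂ × ℂ) ∘ (extChartAt (𝓡 4) c).symm) u₀) := by
      rw [comp_apply, hc0]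
      exact hasFDerivAt_blowDown (G.fst_ne_zero_of_mem_src hc)
    exact flatCx.symm.hasFDerivAt.comp u₀ (h2.comp u₀ h1)
  exact hD'.unique (hT.congr_of_eventuallyEq hev)

/-- **Conjugation identity**: the change of tangent coordinates to the exceptional chart
intertwines `J c` with the standard structure `flatI` (since `J = ψ^* i` and `(z, w) ↦ (1/z, w)` is
holomorphic). [cite: Wendl2018, proof of Prop. 2.53 (p. 65)] -/
theorem tangentCoordChange_inP_inB_J {q : G.box} (hq : (q : ℂ × ℂ).1 = 0) {c : punctured p}
    (hc : c ∈ G.src)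
    (hJstd : ∀ x : punctured p, InPuncturedChartBall p G.rad x →
      ∀ (v : TangentSpace (𝓡 4) x) (c : EuclideanSpace ℝ (Fin 4)),
        inner ℝ (fderiv ℝ inversion (extChartAt (𝓡 4) p x.1 - extChartAt (𝓡 4) p p)
          (mfderiv (𝓡 4) 𝓘(ℝ, EuclideanSpace ℝ (Fin 4))
            (fun z : punctured p => extChartAt (𝓡 4) p z.1) x (J x v))) c
        = stdSymplecticForm (fderiv ℝ inversion (extChartAt (𝓡 4) p x.1 - extChartAt (𝓡 4) p p)
          (mfderiv (𝓡 4) 𝓘(ℝ, EuclideanSpace ℝ (Fin 4))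
            (fun z : punctured p => extChartAt (𝓡 4) p z.1) x v)) c)
    (v : EuclideanSpace ℝ (Fin 4)) :
    tangentCoordChange (𝓡 4) (G.inP c) (G.inB q) (G.inP c) (J c v) =
      flatI (tangentCoordChange (𝓡 4) (G.inP c) (G.inB q) (G.inP c) v) := by
  rw [G.tangentCoordChange_inP_inB hq hc, ContinuousLinearMap.comp_apply,
    ContinuousLinearMap.comp_apply, ContinuousLinearMap.comp_apply, ContinuousLinearMap.comp_apply,
    ContinuousLinearEquiv.coe_coe, pencilCoordDeriv_J J hJstd hc.1, blowDownDeriv_smul,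
    flatI_flatCx_symm]

/-! ### Derivatives of the two inclusions -/

/-- **The inclusion of `M ∖ p` has derivative the identity** (in the preferred charts, which are
the same chart downstairs and upstairs). [folklore] -/
theorem hasMFDerivAt_inP (a : punctured p) :
    HasMFDerivAt (𝓡 4) (𝓡 4) G.inP a (ContinuousLinearMap.id ℝ (EuclideanSpace ℝ (Fin 4))) := by
  refine ⟨G.glueData.continuous_inl.continuousAt, ?_⟩
  have h0 : writtenInExtChartAt (𝓡 4) (𝓡 4) a G.inP (extChartAt (𝓡 4) a a) =
      id (extChartAt (𝓡 4) a a) := by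
    simp only [writtenInExtChartAt, comp_apply, id]
    rw [extChartAt_inP_apply, extChartAt_to_inv]
  have hev : writtenInExtChartAt (𝓡 4) (𝓡 4) a G.inP =ᶠ[𝓝[range (𝓡 4)] (extChartAt (𝓡 4) a a)]
      id := by
    have h1 : ∀ᶠ u in 𝓝 (extChartAt (𝓡 4) a a), u ∈ (extChartAt (𝓡 4) a).target :=
      (isOpen_extChartAt_target a).mem_nhds (mem_extChartAt_target a)
    refine (h1.filter_mono nhdsWithin_le_nhds).mono fun u hu => ?_
    simp only [writtenInExtChartAt, comp_apply, id]
    rw [extChartAt_inP_apply, (extChartAt (𝓡 4) a).right_inv hu]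
  exact (hasFDerivWithinAt_id _ _).congr_of_eventuallyEq hev h0

/-- `mfderiv inP = id`. [folklore] -/
theorem mfderiv_inP (a : punctured p) :
    mfderiv (𝓡 4) (𝓡 4) G.inP a = ContinuousLinearMap.id ℝ (EuclideanSpace ℝ (Fin 4)) :=
  (G.hasMFDerivAt_inP a).mfderiv

omit [T2Space M] [IsManifold (𝓡 4) ∞ M] in
/-- The extended chart of the box is the inclusion. [folklore] -/
theorem extChartAt_box_apply (q b : G.box) : extChartAt 𝓘(ℝ, ℂ × ℂ) q b = (b : ℂ × ℂ) := rfl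

omit [T2Space M] [IsManifold (𝓡 4) ∞ M] in
/-- The inverse extended chart of the box on box points. [folklore] -/
theorem extChartAt_box_symm_apply (q : G.box) {v : ℂ × ℂ} (hv : v ∈ G.box) :
    (extChartAt 𝓘(ℝ, ℂ × ℂ) q).symm v = ⟨v, hv⟩ := by
  have h1 : (extChartAt 𝓘(ℝ, ℂ × ℂ) q).symm v = (chartAt (ℂ × ℂ) q).symm v := by
    simp only [extChartAt, OpenPartialHomeomorph.extend_coe_symm, comp_apply,
      modelWithCornersSelf_coe_symm, id]
  rw [h1]
  have h2 : (chartAt (ℂ × ℂ) q) (⟨v, hv⟩ : G.box) = v := rfl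
  conv_lhs => rw [← h2]
  exact (chartAt (ℂ × ℂ) q).left_inv (by rw [chartAt_box_source]; exact mem_univ _)

/-- **The inclusion of the box has derivative `flatCx⁻¹` at the points of the exceptional disc**
(in the box chart downstairs and the exceptional chart upstairs). [folklore] -/
theorem hasMFDerivAt_inB {q : G.box} (hq : (q : ℂ × ℂ).1 = 0) :
    HasMFDerivAt 𝓘(ℝ, ℂ × ℂ) (𝓡 4) G.inB q
      (flatCx.symm : ℂ × ℂ →L[ℝ] EuclideanSpace ℝ (Fin 4)) := by
  refine ⟨G.glueData.continuous_inr.continuousAt, ?_⟩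
  have hev : writtenInExtChartAt 𝓘(ℝ, ℂ × ℂ) (𝓡 4) q G.inB =ᶠ[𝓝[range 𝓘(ℝ, ℂ × ℂ)]
      (extChartAt 𝓘(ℝ, ℂ × ℂ) q q)] fun v => flatCx.symm v := by
    have h1 : ∀ᶠ v in 𝓝 (extChartAt 𝓘(ℝ, ℂ × ℂ) q q), v ∈ (G.box : Set (ℂ × ℂ)) := by
      rw [extChartAt_box_apply]
      exact G.box.isOpen.mem_nhds q.2
    refine (h1.filter_mono nhdsWithin_le_nhds).mono fun v hv => ?_
    simp only [writtenInExtChartAt, comp_apply]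
    rw [G.extChartAt_box_symm_apply q hv, G.extChartAt_inB_apply_inB hq]
  have h0 : writtenInExtChartAt 𝓘(ℝ, ℂ × ℂ) (𝓡 4) q G.inB (extChartAt 𝓘(ℝ, ℂ × ℂ) q q) =
      flatCx.symm (extChartAt 𝓘(ℝ, ℂ × ℂ) q q) := by
    simp only [writtenInExtChartAt, comp_apply]
    rw [extChartAt_box_apply, G.extChartAt_box_symm_apply q q.2, G.extChartAt_inB_apply_inB hq]
  exact (flatCx.symm.hasFDerivAt.hasFDerivWithinAt).congr_of_eventuallyEq hev h0

/-- `mfderiv inB = flatCx⁻¹` at the points of the exceptional disc. [folklore] -/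
theorem mfderiv_inB {q : G.box} (hq : (q : ℂ × ℂ).1 = 0) :
    mfderiv 𝓘(ℝ, ℂ × ℂ) (𝓡 4) G.inB q = (flatCx.symm : ℂ × ℂ →L[ℝ] EuclideanSpace ℝ (Fin 4)) :=
  (G.hasMFDerivAt_inB hq).mfderiv

/-! ### Smoothness at the exceptional disc and the packaged structure -/

/-- **In tangent coordinates centred at a point of the exceptional disc, `JY` is the constant
`flatI` on the whole image of the box.** [cite: Wendl2018, proof of Prop. 2.53 (p. 65)] -/
theorem inTangentCoordinates_JY_inB {q : G.box} (hq : (q : ℂ × ℂ).1 = 0)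
    (hJstd : ∀ x : punctured p, InPuncturedChartBall p G.rad x →
      ∀ (v : TangentSpace (𝓡 4) x) (c : EuclideanSpace ℝ (Fin 4)),
        inner ℝ (fderiv ℝ inversion (extChartAt (𝓡 4) p x.1 - extChartAt (𝓡 4) p p)
          (mfderiv (𝓡 4) 𝓘(ℝ, EuclideanSpace ℝ (Fin 4))
            (fun z : punctured p => extChartAt (𝓡 4) p z.1) x (J x v))) c
        = stdSymplecticForm (fderiv ℝ inversion (extChartAt (𝓡 4) p x.1 - extChartAt (𝓡 4) p p)
          (mfderiv (𝓡 4) 𝓘(ℝ, EuclideanSpace ℝ (Fin 4))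
            (fun z : punctured p => extChartAt (𝓡 4) p z.1) x v)) c)
    (b : G.box) :
    inTangentCoordinates (𝓡 4) (𝓡 4) (id : G.Y → G.Y) id (fun y => G.JY J y) (G.inB q) (G.inB b) =
      flatI := by
  have hsrc : G.inB b ∈ (chartAt (EuclideanSpace ℝ (Fin 4)) (G.inB q)).source := by
    rw [← extChartAt_source (𝓡 4), extChartAt_inB_source G hq]; exact ⟨b, rfl⟩
  have hsrc' : G.inB b ∈ (extChartAt (𝓡 4) (G.inB q)).source := by
    rw [extChartAt_source]; exact hsrc
  by_cases hb : (b : ℂ × ℂ).1 = 0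
  · rw [inTangentCoordinates_eq (id : G.Y → G.Y) id (fun y => G.JY J y) (x₀ := G.inB q)
      (x := G.inB b) hsrc hsrc]
    dsimp only [id]
    rw [JY_inB G J hb]
    refine ContinuousLinearMap.ext fun v => ?_
    simp only [ContinuousLinearMap.comp_apply]
    change tangentCoordChange (𝓡 4) (G.inB b) (G.inB q) (G.inB b)
      (flatI (tangentCoordChange (𝓡 4) (G.inB q) (G.inB b) (G.inB b) v)) = flatI v
    rw [G.tangentCoordChange_inB_inB hq hb hsrc', G.tangentCoordChange_inB_inB hb hq
      (mem_extChartAt_source (G.inB b))]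
  · -- `inB b = inP c` with `c` in the gluing region
    set c := G.glueInv b with hcdef
    have hbt : b ∈ G.tgt := hb
    have hc : c ∈ G.src := G.glueInv_mem_src hbt
    have hcb : G.inP c = G.inB b := by
      rw [inP_eq_inB_iff]; exact ⟨hc, G.glueFun_glueInv hbt⟩
    rw [← hcb] at hsrc hsrc' ⊢
    rw [inTangentCoordinates_eq (id : G.Y → G.Y) id (fun y => G.JY J y) (x₀ := G.inB q)
      (x := G.inP c) hsrc hsrc]
    dsimp only [id]
    rw [JY_inP]
    refine ContinuousLinearMap.ext fun v => ?_
    simp only [ContinuousLinearMap.comp_apply]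
    change tangentCoordChange (𝓡 4) (G.inP c) (G.inB q) (G.inP c)
      (J c (tangentCoordChange (𝓡 4) (G.inB q) (G.inP c) (G.inP c) v)) = flatI v
    rw [G.tangentCoordChange_inP_inB_J J hq hc hJstd]
    congr 1
    rw [tangentCoordChange_comp (w := G.inB q) (x := G.inP c) (y := G.inB q) (z := G.inP c)
      ⟨⟨hsrc', mem_extChartAt_source (G.inP c)⟩, hsrc'⟩]
    exact tangentCoordChange_self hsrc'

/-- **Smoothness of `JY` at the points of the exceptional disc** (it is constant in the exceptional
chart). [cite: Wendl2018, proof of Prop. 2.53 (p. 65)] -/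
theorem contMDiffAt_inTangentCoordinates_JY_inB {q : G.box} (hq : (q : ℂ × ℂ).1 = 0)
    (hJstd : ∀ x : punctured p, InPuncturedChartBall p G.rad x →
      ∀ (v : TangentSpace (𝓡 4) x) (c : EuclideanSpace ℝ (Fin 4)),
        inner ℝ (fderiv ℝ inversion (extChartAt (𝓡 4) p x.1 - extChartAt (𝓡 4) p p)
          (mfderiv (𝓡 4) 𝓘(ℝ, EuclideanSpace ℝ (Fin 4))
            (fun z : punctured p => extChartAt (𝓡 4) p z.1) x (J x v))) c
        = stdSymplecticForm (fderiv ℝ inversion (extChartAt (𝓡 4) p x.1 - extChartAt (𝓡 4) p p)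
          (mfderiv (𝓡 4) 𝓘(ℝ, EuclideanSpace ℝ (Fin 4))
            (fun z : punctured p => extChartAt (𝓡 4) p z.1) x v)) c) :
    ContMDiffAt (𝓡 4) 𝓘(ℝ, EuclideanSpace ℝ (Fin 4) →L[ℝ] EuclideanSpace ℝ (Fin 4)) ∞
      (inTangentCoordinates (𝓡 4) (𝓡 4) (id : G.Y → G.Y) id (fun y => G.JY J y) (G.inB q))
      (G.inB q) := by
  refine (contMDiffAt_const (c := flatI)).congr_of_eventuallyEq ?_
  filter_upwards [G.glueData.isOpen_range_inr.mem_nhds ⟨q, rfl⟩]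
  rintro _ ⟨b, rfl⟩
  exact G.inTangentCoordinates_JY_inB J hq hJstd b

/-- **The almost complex structure of the blown-up partial end-compactification**, packaged as an
`AlmostComplexStructure (𝓡 4) ∞ Y`: `J` on `M ∖ p`, the standard structure on the box.
[cite: Wendl2018, proof of Prop. 2.53 (p. 65)] -/
def acsY (hJ2 : ∀ (x : punctured p) (v : EuclideanSpace ℝ (Fin 4)), J x (J x v) = -v)
    (hJs : ∀ x₀ : punctured p, ContMDiffAt (𝓡 4) 𝓘(ℝ, EuclideanSpace ℝ (Fin 4) →L[ℝ]
      EuclideanSpace ℝ (Fin 4)) ∞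
      (inTangentCoordinates (𝓡 4) (𝓡 4) (id : punctured p → punctured p) id (fun x => J x) x₀) x₀)
    (hJstd : ∀ x : punctured p, InPuncturedChartBall p G.rad x →
      ∀ (v : TangentSpace (𝓡 4) x) (c : EuclideanSpace ℝ (Fin 4)),
        inner ℝ (fderiv ℝ inversion (extChartAt (𝓡 4) p x.1 - extChartAt (𝓡 4) p p)
          (mfderiv (𝓡 4) 𝓘(ℝ, EuclideanSpace ℝ (Fin 4))
            (fun z : punctured p => extChartAt (𝓡 4) p z.1) x (J x v))) c
        = stdSymplecticForm (fderiv ℝ inversion (extChartAt (𝓡 4) p x.1 - extChartAt (𝓡 4) p p)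
          (mfderiv (𝓡 4) 𝓘(ℝ, EuclideanSpace ℝ (Fin 4))
            (fun z : punctured p => extChartAt (𝓡 4) p z.1) x v)) c) :
    AlmostComplexStructure (𝓡 4) ∞ G.Y :=
  AlmostComplexStructure.ofPointwise (fun y => G.JY J y) (G.JY_JY J hJ2) fun y₀ => by
    rcases G.glueData.exists_inl_or_inr y₀ with ⟨a, rfl⟩ | ⟨b, rfl⟩
    · exact G.contMDiffAt_inTangentCoordinates_JY_inP J hJs a
    · by_cases hb : (b : ℂ × ℂ).1 = 0
      · exact G.contMDiffAt_inTangentCoordinates_JY_inB J hb hJstd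
      · have hcb : G.inP (G.glueInv b) = G.glueData.inr b :=
          G.inP_eq_inB_iff.2 ⟨G.glueInv_mem_src hb, G.glueFun_glueInv hb⟩
        rw [← hcb]
        exact G.contMDiffAt_inTangentCoordinates_JY_inP J hJs _

/-- The packaged structure is `JY` pointwise. [folklore] -/
@[simp] theorem acsY_apply (hJ2 : ∀ (x : punctured p) (v : EuclideanSpace ℝ (Fin 4)), J x (J x v) = -v)
    (hJs : ∀ x₀ : punctured p, ContMDiffAt (𝓡 4) 𝓘(ℝ, EuclideanSpace ℝ (Fin 4) →L[ℝ]
      EuclideanSpace ℝ (Fin 4)) ∞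
      (inTangentCoordinates (𝓡 4) (𝓡 4) (id : punctured p → punctured p) id (fun x => J x) x₀) x₀)
    (hJstd : ∀ x : punctured p, InPuncturedChartBall p G.rad x →
      ∀ (v : TangentSpace (𝓡 4) x) (c : EuclideanSpace ℝ (Fin 4)),
        inner ℝ (fderiv ℝ inversion (extChartAt (𝓡 4) p x.1 - extChartAt (𝓡 4) p p)
          (mfderiv (𝓡 4) 𝓘(ℝ, EuclideanSpace ℝ (Fin 4))
            (fun z : punctured p => extChartAt (𝓡 4) p z.1) x (J x v))) c
        = stdSymplecticForm (fderiv ℝ inversion (extChartAt (𝓡 4) p x.1 - extChartAt (𝓡 4) p p)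
          (mfderiv (𝓡 4) 𝓘(ℝ, EuclideanSpace ℝ (Fin 4))
            (fun z : punctured p => extChartAt (𝓡 4) p z.1) x v)) c) (y : G.Y) :
    G.acsY J hJ2 hJs hJstd y = G.JY J y := rfl

end PencilEnd

end Literature.Geometry.Symplectic
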